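import Literature.MathematicalPhysics.QuantumFieldTheory.Balaban1983to89.B13Bound226Located
import Literature.MathematicalPhysics.QuantumFieldTheory.Balaban1983to89.B13GaussParamHolomorphic

/-!
# Spine/NE5/TwoRunPrimitivePencil — the AFFINE two-run pencil of the PRIMITIVE kernels of (2.14) stays in the located
# class: letters along the pencil from the two runs' letters + the primitive-level two-run rate (W1), Re-positivity and
# invertibility of the precision along the pencil from the letters (cell `pub-balaban-gaps`, seat `ne5` gen 8)

WHY.  `Spine/NE5/TwoRunTorusPrimitiveParam.hol_and_h226_torus_of_primitives_param` (T21) turns «primitive kernel families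
`b ↦ (A b σ, G b σ, 𝐕 b Y)` with the located (2.16)–(2.23) letters UNIFORM in the parameter `b ∈ V` + entrywise
holomorphy + symmetry and `Re A ≻ 0`» into both inputs of NE5's torus chain (T14 `norm_E_sub_le_torus`, `B = ℂ`,
`V = ball 0 ρ`).  For NE5 the parameter family is the TWO-RUN PENCIL: run A's primitives `A₀(σ)`, `G₀(σ)` (spacing η, read
through the transport) and run B's `A₁(σ)`, `G₁(σ)` (spacing η∕L) at the paired scale live on the SAME bond sets (the
unit lattice of the common torus), and the pencil is AFFINE: `A_θ = A₀ + θ·(A₁ − A₀)`, `G_θ = G₀ + θ·(G₁ − G₀)`.  THIS FILE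
proves, at the level of located matrices (site space `S`, weight `ρ`, lattice constant `Kc`, bonds located with `≤ m` per
site — the setting of `B13Bound226Located`), that the pencil's letters on the disc `‖θ‖ < ρ` follow from RUN A's letters
and the PRIMITIVE-LEVEL TWO-RUN RATE `‖(A₁ − A₀)(σ)‖_{bb′} ≤ r_A e^{−κρ}`, `‖(G₁ − G₀)(σ)‖_{bj} ≤ r_G e^{−κρ}` (rows NE2∕NE3's
W1 in the currency of [II] (1.5)∕(1.7), King's «difference of propagators on one line»):
* §1 affine letters: localisation `K_G + ρr_G` and differences `θ_Γ + ρr_G`, `θ_E + ρr_A` (same rate κ); entrywise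
  holomorphy in θ (affine) and symmetry;
* §2 the inverse along the pencil by the tree's weighted-row-sum algebra (`B13PerturbativeStep.WRS.inv_add`,
  `norm_inv_add_sub_inv_apply_le`): `A_θ` is invertible and `‖A_θ⁻¹‖_{bb′} ≤ K′e^{−κ′ρ}`, `‖A_θ⁻¹ − C‖_{bb′} ≤ θ′_C e^{−κ′ρ}` at
  any dropped rate `κ′ < κ`, with `K′ = K∕(1 − Kϑ)`, `θ′_C = θ_C + KϑK∕(1 − Kϑ)`, `K = K_{Cσ}·mKc(κ−κ′)`, `ϑ = ρr_A·mKc(κ−κ′)`,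
  under `Kϑ < 1` — the precision's rate-drop window (x5);
* §3 `Re A_θ ≻ 0` FROM THE LETTERS: an entrywise (2.16)-bound `‖A − C⁻¹‖_{bb′} ≤ θ_E e^{−κρ}` with `θ_E·mKc(κ)·λ_max(C) < 1`
  forces `Re A ≻ C⁻¹ − θ_E mKc(κ)·1 ≻ 0` (`hR2_of_entrywise` + `posDef_inv_sub_smul`) — so (J3) of the junction list is not an
  extra input along the pencil once run A's `θ_E` and the window `ρr_A` are small against `λ_max(C)`;
* §4 σ- and θ-slots of the pencil (entrywise holomorphy: `hAhol hGhol hAholb hGholb` of T21 §2 with `b := θ`);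
* §5 the pencil of POTENTIALS `𝐕_θ = 𝐕₀ + θ(𝐕₁ − 𝐕₀)`: (2.20) along the pencil with `(a + ρa′, w + ρw′)` from run A's (2.20)
  and a (2.20)-shaped bound on the DIFFERENCE `𝐕₁ − 𝐕₀` (the history channel's two-run rate, W3 in primitive currency),
  holomorphy in θ and measurability in the field (`h220U hVholb hVm` of T21 §2).
So for `‖θ‖ < ρ` the pencil satisfies, at the dropped rate `κ′`, EVERY operator and potential hypothesis of T21 §2 with
`b := θ`, constants explicit (for NE5 `ρ = s∕r_j` and `r_A, r_G ∝ r_j`, so `ϑ = ρr_A·mKc(κ−κ′)` is j-independent — (x5)).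
LEDGER MEANING (row NE5, `HOME/ne/NE5.md` §14 junction list): (J1)–(J4) ALONG NE5's PENCIL are now consequences of the
per-run data at run A (NODE O∕A: letters, (2.20)) + the primitive-level two-run rates (rows NE2∕NE3 for `A, G`; the history
channel for `𝐕`) on the window `‖θ‖ < ρ = s∕r_j`; what T21 still takes from elsewhere is run A's data themselves, (J5) the
common characteristic functions and (J6) the constants.
The walk layer (T8∕T9∕T12: the walk-expanded families stay in class along the pencil) is the same statement one layer
down; this file is the elementary matrix form the formula layer consumes directly.

HONEST FRAMING.  Finite-dimensional located-matrix algebra over LANDED shapes (`WRS`, `B13Bound226Located`); every kernel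
family, rate and constant is a HYPOTHESIS; nothing of Bałaban's `C^{(k)}(Z₀,σ)`, `Γ_k(Z₀,σ)` or of the two-run rate is
constructed or asserted; NE5 NOT PRINTED ∕ NOT PROVED; leaves 0∕12; (D4) 0∕1; spine 0∕9.  Rung (B)+1 on a FIXED finite
T⁴ — NOT continuum, NOT infinite volume, NOT mass gap, NOT Clay.  HONEST DEPENDENCY: continuum YM on T⁴ ⇐ BetaPertH ∧ nine
spine estimates; BetaPertH ⇐ (D1) ∧ (D4) ∧ CAP+tail.  0 sorry, 0 `def`.

Sources: [II] = T. Bałaban, CMP **116** (1988) [Balaban1988RG2Cluster] (1.5)∕(1.7) p. 3, (2.16)–(2.17) p. 16, (2.20)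
p. 16, (2.24) p. 17; C. King, CMP **102** (1986) [King1986] p. 665 («the error is the same graph with a difference of propagators on one
line»).  Nothing here is a claim about the Yang–Mills mass gap.
-/

noncomputable section

namespace Summit.QuantumFields.BalabanUV.T4Continuum.Spine.NE5.TwoRunPrimitivePencil

open Matrix Metric Set Finset
open Literature.MathematicalPhysics.QuantumFieldTheory.Balaban1983to89
open Literature.MathematicalPhysics.QuantumFieldTheory.Balaban1983to89.B13PerturbativeStep (WRS WeightHyp)
open Literature.MathematicalPhysics.QuantumFieldTheory.Balaban1983to89.B13Bound226Located
  (WRS_of_entrywise_loc weightHyp_loc hR2_of_entrywise Kc_nonneg)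
open Literature.MathematicalPhysics.QuantumFieldTheory.Balaban1983to89.B13Integral223 (posDef_inv_sub_smul)
open Literature.MathematicalPhysics.QuantumFieldTheory.Balaban1983to89.B13GaussParamHolomorphic (det_ne_zero_of_re_posDef)

/-! ## §1. Affine pencils of located kernels: localisation, differences, holomorphy, symmetry -/

section Affine

variable {m n : Type*} {w : m → n → ℝ}

/-- **Localisation along an affine pencil**: `‖X‖ ≤ K·w`, `‖Y − X‖ ≤ r·w` entrywise and `‖θ‖ ≤ ρ` give
`‖X + θ(Y − X)‖ ≤ (K + ρr)·w` entrywise. [cite: Balaban1988RG2Cluster, (1.7) p.3; King1986, p.665] -/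
theorem norm_pencil_apply_le {X Y : Matrix m n ℂ} {K r ρ : ℝ} {θ : ℂ} (hθ : ‖θ‖ ≤ ρ)
    (hX : ∀ i j, ‖X i j‖ ≤ K * w i j) (hYX : ∀ i j, ‖(Y - X) i j‖ ≤ r * w i j) (i : m) (j : n) :
    ‖(X + θ • (Y - X)) i j‖ ≤ (K + ρ * r) * w i j := by
  rw [Matrix.add_apply, Matrix.smul_apply, smul_eq_mul]
  calc ‖X i j + θ * (Y - X) i j‖ ≤ ‖X i j‖ + ‖θ‖ * ‖(Y - X) i j‖ := (norm_add_le _ _).trans (by rw [norm_mul])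
    _ ≤ K * w i j + ρ * (r * w i j) :=
        add_le_add (hX i j) (mul_le_mul hθ (hYX i j) (norm_nonneg _) ((norm_nonneg θ).trans hθ))
    _ = (K + ρ * r) * w i j := by ring

/-- **Differences along an affine pencil**: `‖X − R‖ ≤ θ₀·w`, `‖Y − X‖ ≤ r·w` entrywise and `‖θ‖ ≤ ρ` give
`‖(X + θ(Y − X)) − R‖ ≤ (θ₀ + ρr)·w` entrywise. [cite: Balaban1988RG2Cluster, (2.16) p.16; King1986, p.665] -/
theorem norm_pencil_sub_apply_le {X Y R : Matrix m n ℂ} {θ₀ r ρ : ℝ} {θ : ℂ} (hθ : ‖θ‖ ≤ ρ)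
    (hX : ∀ i j, ‖(X - R) i j‖ ≤ θ₀ * w i j) (hYX : ∀ i j, ‖(Y - X) i j‖ ≤ r * w i j)
    (i : m) (j : n) : ‖(X + θ • (Y - X) - R) i j‖ ≤ (θ₀ + ρ * r) * w i j := by
  have e : X + θ • (Y - X) - R = (X - R) + θ • (Y - X) := by abel
  rw [e, Matrix.add_apply, Matrix.smul_apply, smul_eq_mul]
  calc ‖(X - R) i j + θ * (Y - X) i j‖ ≤ ‖(X - R) i j‖ + ‖θ‖ * ‖(Y - X) i j‖ :=
        (norm_add_le _ _).trans (by rw [norm_mul])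
    _ ≤ θ₀ * w i j + ρ * (r * w i j) :=
        add_le_add (hX i j) (mul_le_mul hθ (hYX i j) (norm_nonneg _) ((norm_nonneg θ).trans hθ))
    _ = (θ₀ + ρ * r) * w i j := by ring

/-- **Affine pencils are entire in the parameter**, entrywise. [folklore] [cite: King1986, p.665] -/
theorem differentiableOn_pencil_apply (X Y : Matrix m n ℂ) (V : Set ℂ) (i : m) (j : n) :
    DifferentiableOn ℂ (fun θ : ℂ => (X + θ • (Y - X)) i j) V := by
  have e : (fun θ : ℂ => (X + θ • (Y - X)) i j) = fun θ => X i j + θ * (Y - X) i j := by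
    funext θ; rw [Matrix.add_apply, Matrix.smul_apply, smul_eq_mul]
  rw [e]
  exact ((differentiableOn_const _).add (differentiableOn_id.mul (differentiableOn_const _)))

/-- **Affine pencils of symmetric matrices are symmetric.** [folklore] [cite: Balaban1988RG2Cluster, p.15] -/
theorem isSymm_pencil {X Y : Matrix n n ℂ} (hX : X.IsSymm) (hY : Y.IsSymm) (θ : ℂ) : (X + θ • (Y - X)).IsSymm :=
  (hX.add ((hY.sub hX).smul θ))

end Affine

/-! ## §2. The inverse of the precision along the pencil (weighted-row-sum algebra at a dropped rate) -/

section Inverse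

variable {S : Type*} [DecidableEq S] {ρd : S → S → ℝ} {Kc : ℝ → ℝ}
variable {Λ : Type} [Fintype Λ] [DecidableEq Λ]

/-- A symmetric complex matrix with positive definite real part is a unit (its determinant is non-zero:
`B13GaussParamHolomorphic.det_ne_zero_of_re_posDef`). [cite: Balaban1988RG2Cluster, (2.15) p.15] -/
theorem isUnit_of_re_posDef {X : Matrix Λ Λ ℂ} (hXs : X.IsSymm) (hX : (X.map Complex.re).PosDef) : IsUnit X :=
  (Matrix.isUnit_iff_isUnit_det X).2 (isUnit_iff_ne_zero.2 (det_ne_zero_of_re_posDef hXs hX))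

/-- **THE PRECISION ALONG THE PENCIL IS INVERTIBLE WITH A LOCALISED INVERSE, CLOSE TO THE REFERENCE** (print's
«R₂, R₃ satisfy (2.16) also», p. 16, along NE5's two-run pencil).  Located bonds `Λ → S` (`≤ m` per site), run A's
precision `X = A₀(σ)` symmetric with `Re X ≻ 0`, its inverse localised `‖X⁻¹‖_{bb′} ≤ K_{Cσ}e^{−κρ}` and close to the
reference `‖X⁻¹ − C‖_{bb′} ≤ θ_C e^{−κρ}`, and the primitive two-run rate `‖(A₁ − A₀)(σ)‖_{bb′} ≤ r_A e^{−κρ}`; then for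
`‖θ‖ ≤ ρ` and any rate `0 ≤ κ′ < κ`, with `K = K_{Cσ}·mKc(κ−κ′)`, `ϑ = ρr_A·mKc(κ−κ′)` and `Kϑ < 1`: the member
`A_θ = X + θ(A₁ − A₀)` is a unit, `‖A_θ⁻¹‖_{bb′} ≤ (1 − Kϑ)⁻¹K·e^{−κ′ρ}` and `‖A_θ⁻¹ − C‖_{bb′} ≤ (Kϑ(1 − Kϑ)⁻¹K + θ_C)·e^{−κ′ρ}`
(`B13PerturbativeStep.WRS.inv_add` ∕ `norm_inv_add_sub_inv_apply_le`, the WRS constants from the entrywise letters by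
`B13Bound226Located.WRS_of_entrywise_loc`). [cite: Balaban1988RG2Cluster, (2.16) p.16; King1986, p.665] -/
theorem inv_pencil_letters (hρ : WeightHyp 0 ρd)
    (hKc : ∀ b : ℝ, 0 < b → ∀ (T : Finset S) (x : S), ∑ y ∈ T, Real.exp (-(b * ρd x y)) ≤ Kc b)
    {X Y : Matrix Λ Λ ℂ} {C : Matrix Λ Λ ℝ} (hXs : X.IsSymm) (hX : (X.map Complex.re).PosDef)
    {KCs θC rA κ κ' ρ : ℝ} (hKCs : 0 ≤ KCs) (hθC : 0 ≤ θC) (hrA : 0 ≤ rA) (hρ0 : 0 ≤ ρ) (hκ' : 0 ≤ κ')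
    (hκ : κ' < κ) (locΛ : Λ → S) {m : ℕ} (hfib : ∀ x : S, (Finset.univ.filter fun i => locΛ i = x).card ≤ m)
    (hCs : ∀ b b', ‖X⁻¹ b b'‖ ≤ KCs * Real.exp (-(κ * ρd (locΛ b) (locΛ b'))))
    (hdC : ∀ b b', ‖(X⁻¹ - C.map (algebraMap ℝ ℂ)) b b'‖ ≤ θC * Real.exp (-(κ * ρd (locΛ b) (locΛ b'))))
    (hYX : ∀ b b', ‖(Y - X) b b'‖ ≤ rA * Real.exp (-(κ * ρd (locΛ b) (locΛ b'))))
    (hsmall : KCs * (m * Kc (κ - κ')) * (ρ * rA * (m * Kc (κ - κ'))) < 1) {θ : ℂ} (hθ : ‖θ‖ ≤ ρ) :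
    IsUnit (X + θ • (Y - X)) ∧
      (∀ b b', ‖(X + θ • (Y - X))⁻¹ b b'‖ ≤
        (1 - KCs * (m * Kc (κ - κ')) * (ρ * rA * (m * Kc (κ - κ'))))⁻¹ * (KCs * (m * Kc (κ - κ')))
          * Real.exp (-(κ' * ρd (locΛ b) (locΛ b')))) ∧
      (∀ b b', ‖((X + θ • (Y - X))⁻¹ - C.map (algebraMap ℝ ℂ)) b b'‖ ≤
        (KCs * (m * Kc (κ - κ')) * (ρ * rA * (m * Kc (κ - κ')))
            * (1 - KCs * (m * Kc (κ - κ')) * (ρ * rA * (m * Kc (κ - κ'))))⁻¹ * (KCs * (m * Kc (κ - κ'))) + θC)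
          * Real.exp (-(κ' * ρd (locΛ b) (locΛ b')))) := by
  have hw : WeightHyp κ' (fun i j : Λ => ρd (locΛ i) (locΛ j)) := weightHyp_loc hρ hκ' locΛ
  have hM : IsUnit X := isUnit_of_re_posDef hXs hX
  -- WRS constants of `X⁻¹` and of the perturbation `θ(Y − X)` at the dropped rate
  have hK : WRS κ' (fun i j : Λ => ρd (locΛ i) (locΛ j)) X⁻¹ (KCs * (m * Kc (κ - κ'))) :=
    WRS_of_entrywise_loc hKc hKCs hκ locΛ hfib hCs
  have hRent : ∀ b b', ‖(θ • (Y - X)) b b'‖ ≤ ρ * rA * Real.exp (-(κ * ρd (locΛ b) (locΛ b'))) := by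
    intro b b'
    rw [Matrix.smul_apply, smul_eq_mul, norm_mul, mul_assoc]
    exact mul_le_mul hθ (hYX b b') (norm_nonneg _) hρ0
  have hR : WRS κ' (fun i j : Λ => ρd (locΛ i) (locΛ j)) (θ • (Y - X)) (ρ * rA * (m * Kc (κ - κ'))) :=
    WRS_of_entrywise_loc hKc (mul_nonneg hρ0 hrA) hκ locΛ hfib hRent
  refine ⟨B13PerturbativeStep.isUnit_add hw hM hK hR hsmall, fun b b' => ?_, fun b b' => ?_⟩
  · exact (B13PerturbativeStep.WRS.inv_add hw hM hK hR hsmall).norm_apply_le b b'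
  · have h1 := B13PerturbativeStep.norm_inv_add_sub_inv_apply_le hw hM hK hR hsmall b b'
    have h2 : ‖(X⁻¹ - C.map (algebraMap ℝ ℂ)) b b'‖ ≤ θC * Real.exp (-(κ' * ρd (locΛ b) (locΛ b'))) :=
      (hdC b b').trans (mul_le_mul_of_nonneg_left (Real.exp_le_exp.2
        (neg_le_neg (mul_le_mul_of_nonneg_right hκ.le (hρ.nonneg _ _)))) hθC)
    have e : (X + θ • (Y - X))⁻¹ - C.map (algebraMap ℝ ℂ) =
        ((X + θ • (Y - X))⁻¹ - X⁻¹) + (X⁻¹ - C.map (algebraMap ℝ ℂ)) := by abel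
    rw [e, Matrix.add_apply]
    calc ‖((X + θ • (Y - X))⁻¹ - X⁻¹) b b' + (X⁻¹ - C.map (algebraMap ℝ ℂ)) b b'‖
        ≤ ‖((X + θ • (Y - X))⁻¹ - X⁻¹) b b'‖ + ‖(X⁻¹ - C.map (algebraMap ℝ ℂ)) b b'‖ := norm_add_le _ _
      _ ≤ _ := by rw [add_mul]; exact add_le_add h1 h2

end Inverse

/-! ## §3. `Re A ≻ 0` from the (2.16)-letter against the reference -/

section RePos

variable {S : Type*} [DecidableEq S] {ρd : S → S → ℝ} {Kc : ℝ → ℝ}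
variable {Λ : Type} [Fintype Λ] [DecidableEq Λ]

/-- **POSITIVITY OF THE REAL PART FROM THE LETTERS** (junction (J3) along a pencil is not an extra input): if `A` is
symmetric, the reference covariance `C ≻ 0` has eigenvalues `≤ c`, and the entrywise (2.16)-letter
`‖(A − C⁻¹)(b,b′)‖ ≤ θ_E e^{−κρ(b,b′)}` holds on bonds located with `≤ m` per site, then `⟨B,(C⁻¹ − Re A)B⟩ ≤ θ_E·mKc(κ)·‖B‖²`
(`hR2_of_entrywise`) and `C⁻¹ − θ_E mKc(κ)·1 ≻ 0` when `θ_E·mKc(κ)·c < 1` (`posDef_inv_sub_smul`, (2.24)); hence `Re A ≻ 0`.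
[cite: Balaban1988RG2Cluster, (2.16) p.16, (2.24) p.17, p.15] -/
theorem re_posDef_of_letter (hρ : WeightHyp 0 ρd) (hρs : ∀ x y : S, ρd x y = ρd y x)
    (hKc : ∀ b : ℝ, 0 < b → ∀ (T : Finset S) (x : S), ∑ y ∈ T, Real.exp (-(b * ρd x y)) ≤ Kc b)
    {A : Matrix Λ Λ ℂ} {C : Matrix Λ Λ ℝ} (hC : C.PosDef) (hAs : A.IsSymm) {θE κ c : ℝ} (hθE : 0 ≤ θE)
    (hκ : 0 < κ) (locΛ : Λ → S) {m : ℕ} (hfib : ∀ x : S, (Finset.univ.filter fun i => locΛ i = x).card ≤ m)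
    (hE : ∀ b b', ‖(A - C⁻¹.map (algebraMap ℝ ℂ)) b b'‖ ≤ θE * Real.exp (-(κ * ρd (locΛ b) (locΛ b'))))
    (hc : ∀ k, hC.1.eigenvalues k ≤ c) (hsmall : θE * (m * Kc κ) * c < 1) :
    (A.map Complex.re).PosDef := by
  have hR2 := hR2_of_entrywise (A := A) (C := C) hρ hρs hKc hθE hκ locΛ hfib hE
  have hP := posDef_inv_sub_smul hC hc hsmall
  refine Matrix.PosDef.of_dotProduct_mulVec_pos (Matrix.isHermitian_iff_isSymm.2 (hAs.map _)) fun x hx => ?_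
  have h1 : 0 < x ⬝ᵥ ((C⁻¹ - (θE * (m * Kc κ)) • (1 : Matrix Λ Λ ℝ)) *ᵥ x) := by
    simpa using hP.dotProduct_mulVec_pos hx
  have h2 : x ⬝ᵥ ((C⁻¹ - (θE * (m * Kc κ)) • (1 : Matrix Λ Λ ℝ)) *ᵥ x) =
      x ⬝ᵥ (C⁻¹ *ᵥ x) - θE * (m * Kc κ) * (x ⬝ᵥ x) := by
    rw [Matrix.sub_mulVec, dotProduct_sub, Matrix.smul_mulVec, Matrix.one_mulVec, dotProduct_smul, smul_eq_mul]
  have h3 : x ⬝ᵥ ((C⁻¹ - A.map Complex.re) *ᵥ x) = x ⬝ᵥ (C⁻¹ *ᵥ x) - x ⬝ᵥ ((A.map Complex.re) *ᵥ x) := by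
    rw [Matrix.sub_mulVec, dotProduct_sub]
  have h4 := hR2 x
  simp only [star_trivial]
  linarith [h1, h2, h3, h4]

/-- **`Re A_θ ≻ 0` ALONG THE TWO-RUN PENCIL** (run A's letter `θ_E`, the primitive two-run rate `r_A` and the window
`‖θ‖ ≤ ρ`): `‖(A₀ − C⁻¹)(b,b′)‖ ≤ θ_E e^{−κρ}`, `‖(A₁ − A₀)(b,b′)‖ ≤ r_A e^{−κρ}`, both members symmetric, and
`(θ_E + ρr_A)·mKc(κ)·c < 1` (`c ≥ λ_max(C)`) ⇒ `Re (A₀ + θ(A₁ − A₀)) ≻ 0` — hypothesis `hA` of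
`TwoRunTorusPrimitiveParam.hol_and_h226_torus_of_primitives_param` along NE5's pencil.
[cite: Balaban1988RG2Cluster, (2.16) p.16, (2.24) p.17; King1986, p.665] -/
theorem re_posDef_pencil (hρ : WeightHyp 0 ρd) (hρs : ∀ x y : S, ρd x y = ρd y x)
    (hKc : ∀ b : ℝ, 0 < b → ∀ (T : Finset S) (x : S), ∑ y ∈ T, Real.exp (-(b * ρd x y)) ≤ Kc b)
    {X Y : Matrix Λ Λ ℂ} {C : Matrix Λ Λ ℝ} (hC : C.PosDef) (hXs : X.IsSymm) (hYs : Y.IsSymm)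
    {θE rA ρ κ c : ℝ} (hθE : 0 ≤ θE) (hrA : 0 ≤ rA) (hρ0 : 0 ≤ ρ) (hκ : 0 < κ) (locΛ : Λ → S) {m : ℕ}
    (hfib : ∀ x : S, (Finset.univ.filter fun i => locΛ i = x).card ≤ m)
    (hE : ∀ b b', ‖(X - C⁻¹.map (algebraMap ℝ ℂ)) b b'‖ ≤ θE * Real.exp (-(κ * ρd (locΛ b) (locΛ b'))))
    (hYX : ∀ b b', ‖(Y - X) b b'‖ ≤ rA * Real.exp (-(κ * ρd (locΛ b) (locΛ b'))))
    (hc : ∀ k, hC.1.eigenvalues k ≤ c) (hsmall : (θE + ρ * rA) * (m * Kc κ) * c < 1) {θ : ℂ} (hθ : ‖θ‖ ≤ ρ) :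
    ((X + θ • (Y - X)).map Complex.re).PosDef :=
  re_posDef_of_letter hρ hρs hKc hC (isSymm_pencil hXs hYs θ) (by positivity) hκ locΛ hfib
    (norm_pencil_sub_apply_le hθ hE hYX) hc hsmall

end RePos

/-! ## §4. Regularity of the pencil in σ (the σ-slot letters `hAhol`, `hGhol` of T21 along the pencil) -/

section Sigma

variable {ι : Type*} [Fintype ι] {m n : Type*}

/-- **The pencil member is entrywise holomorphic in σ when both runs' kernels are**: for a fixed `θ`,
`σ ↦ (A₀ σ + θ(A₁ σ − A₀ σ))(i,j)` is complex differentiable on any set on which `σ ↦ A₀ σ (i,j)` and `σ ↦ A₁ σ (i,j)` are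
(hypotheses `hAhol`, `hGhol` of `TwoRunTorusPrimitiveParam.hol_and_h226_torus_of_primitives_param` for the member `b = θ`).
[cite: Balaban1988RG2Cluster, p.15 («analytic functions … of the complex parameters σ(Z)»); King1986, p.665] -/
theorem differentiableOn_pencil_sigma_apply {A₀ A₁ : (ι → ℂ) → Matrix m n ℂ} {P : Set (ι → ℂ)} (θ : ℂ) (i : m) (j : n)
    (h₀ : DifferentiableOn ℂ (fun σ => A₀ σ i j) P) (h₁ : DifferentiableOn ℂ (fun σ => A₁ σ i j) P) :
    DifferentiableOn ℂ (fun σ => (A₀ σ + θ • (A₁ σ - A₀ σ)) i j) P := by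
  have e : (fun σ => (A₀ σ + θ • (A₁ σ - A₀ σ)) i j) = fun σ => A₀ σ i j + θ * (A₁ σ i j - A₀ σ i j) := by
    funext σ; rw [Matrix.add_apply, Matrix.smul_apply, smul_eq_mul, Matrix.sub_apply]
  rw [e]
  exact h₀.add ((differentiableOn_const θ).mul (h₁.sub h₀))

omit [Fintype ι] in
/-- **The pencil member is entrywise holomorphic in the pencil parameter at every σ** (hypotheses `hAholb`, `hGholb` of
T21 §2 with `B = ℂ`): `θ ↦ (A₀ σ + θ(A₁ σ − A₀ σ))(i,j)` is entire. [folklore] [cite: King1986, p.665] -/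
theorem differentiableOn_pencil_param_apply (A₀ A₁ : (ι → ℂ) → Matrix m n ℂ) (σ : ι → ℂ) (V : Set ℂ) (i : m)
    (j : n) : DifferentiableOn ℂ (fun θ : ℂ => (A₀ σ + θ • (A₁ σ - A₀ σ)) i j) V :=
  differentiableOn_pencil_apply (A₀ σ) (A₁ σ) V i j

end Sigma

/-! ## §5. The pencil of potentials: (2.20), holomorphy and measurability along `𝐕_θ = 𝐕₀ + θ(𝐕₁ − 𝐕₀)` -/

section Potentials

variable {D : Type*} {Λ : Type*} [Fintype Λ]

/-- **(2.20) ALONG THE PENCIL OF POTENTIALS** (junction (J4) along NE5's pencil): if run A's potentials obey (2.20)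
`Σ_{Y∈𝐃} |τ(Y)|·‖𝐕₀(Y,B)‖ ≤ ½a‖B‖² + w` and the two runs' DIFFERENCE obeys the same shape
`Σ_{Y∈𝐃} |τ(Y)|·‖𝐕₁(Y,B) − 𝐕₀(Y,B)‖ ≤ ½a′‖B‖² + w′` (the history channel's two-run rate, row NE5's W3 in primitive
currency), then every member `𝐕_θ = 𝐕₀ + θ(𝐕₁ − 𝐕₀)`, `‖θ‖ ≤ ρ`, obeys (2.20) with `(a + ρa′, w + ρw′)` — hypothesis `h220U` of
`TwoRunTorusPrimitiveParam.hol_and_h226_torus_of_primitives_param` along the pencil.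
[cite: Balaban1988RG2Cluster, (2.20) p.16; King1986, p.665] -/
theorem h220_pencil {Dfam : Finset D} {τ : D → ℂ} {V₀ V₁ : D → (Λ → ℝ) → ℂ} {a a' w w' ρ : ℝ} {θ : ℂ}
    (hθ : ‖θ‖ ≤ ρ) (hρ : 0 ≤ ρ) (B : Λ → ℝ)
    (h₀ : ∑ Y ∈ Dfam, ‖τ Y‖ * ‖V₀ Y B‖ ≤ a / 2 * (B ⬝ᵥ B) + w)
    (h₁ : ∑ Y ∈ Dfam, ‖τ Y‖ * ‖V₁ Y B - V₀ Y B‖ ≤ a' / 2 * (B ⬝ᵥ B) + w') :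
    ∑ Y ∈ Dfam, ‖τ Y‖ * ‖V₀ Y B + θ * (V₁ Y B - V₀ Y B)‖ ≤ (a + ρ * a') / 2 * (B ⬝ᵥ B) + (w + ρ * w') := by
  have hterm : ∀ Y ∈ Dfam, ‖τ Y‖ * ‖V₀ Y B + θ * (V₁ Y B - V₀ Y B)‖ ≤
      ‖τ Y‖ * ‖V₀ Y B‖ + ρ * (‖τ Y‖ * ‖V₁ Y B - V₀ Y B‖) := by
    intro Y _
    have h1 : ‖V₀ Y B + θ * (V₁ Y B - V₀ Y B)‖ ≤ ‖V₀ Y B‖ + ρ * ‖V₁ Y B - V₀ Y B‖ := by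
      refine (norm_add_le _ _).trans ?_
      rw [norm_mul]
      exact add_le_add le_rfl (mul_le_mul_of_nonneg_right hθ (norm_nonneg (V₁ Y B - V₀ Y B)))
    have h2 := mul_le_mul_of_nonneg_left h1 (norm_nonneg (τ Y))
    have e : ‖τ Y‖ * (‖V₀ Y B‖ + ρ * ‖V₁ Y B - V₀ Y B‖) =
        ‖τ Y‖ * ‖V₀ Y B‖ + ρ * (‖τ Y‖ * ‖V₁ Y B - V₀ Y B‖) := by ring
    exact h2.trans e.le
  calc ∑ Y ∈ Dfam, ‖τ Y‖ * ‖V₀ Y B + θ * (V₁ Y B - V₀ Y B)‖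
      ≤ ∑ Y ∈ Dfam, (‖τ Y‖ * ‖V₀ Y B‖ + ρ * (‖τ Y‖ * ‖V₁ Y B - V₀ Y B‖)) := Finset.sum_le_sum hterm
    _ = (∑ Y ∈ Dfam, ‖τ Y‖ * ‖V₀ Y B‖) + ρ * ∑ Y ∈ Dfam, ‖τ Y‖ * ‖V₁ Y B - V₀ Y B‖ := by
        rw [Finset.sum_add_distrib, Finset.mul_sum]
    _ ≤ (a / 2 * (B ⬝ᵥ B) + w) + ρ * (a' / 2 * (B ⬝ᵥ B) + w') :=
        add_le_add h₀ (mul_le_mul_of_nonneg_left h₁ hρ)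
    _ = (a + ρ * a') / 2 * (B ⬝ᵥ B) + (w + ρ * w') := by ring

omit [Fintype Λ] in
/-- **The pencil of potentials is entire in the parameter** at every `(Y, B)` (hypothesis `hVholb` of T21 §2). [folklore]
[cite: King1986, p.665] -/
theorem differentiableOn_potential_pencil (V₀ V₁ : D → (Λ → ℝ) → ℂ) (Y : D) (B : Λ → ℝ) (V : Set ℂ) :
    DifferentiableOn ℂ (fun θ : ℂ => V₀ Y B + θ * (V₁ Y B - V₀ Y B)) V :=
  (differentiableOn_const _).add (differentiableOn_id.mul (differentiableOn_const _))

omit [Fintype Λ] in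
/-- **The pencil of potentials is measurable in the field** when both runs' potentials are (hypothesis `hVm` of T21 §2).
[folklore] [cite: Balaban1988RG2Cluster, (2.14) p.15] -/
theorem measurable_potential_pencil [MeasurableSpace (Λ → ℝ)] {V₀ V₁ : D → (Λ → ℝ) → ℂ} (θ : ℂ) (Y : D)
    (h₀ : Measurable (V₀ Y)) (h₁ : Measurable (V₁ Y)) :
    Measurable (fun B : Λ → ℝ => V₀ Y B + θ * (V₁ Y B - V₀ Y B)) :=
  h₀.add ((h₁.sub h₀).const_mul θ)

end Potentials

end Summit.QuantumFields.BalabanUV.T4Continuum.Spine.NE5.TwoRunPrimitivePencil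

end
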